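import Summits.CriticalPhenomena.PercolationContinuityZ3.Theorems.PercNearOneGluingNoHeavyLowerTailKnQuestion8CoefficientwiseCoreClassSeriesMain
import HarnessLib

/-!
# Pendant paths on a series composition: KB-MIX-FULL iterates through both constructions

Support file (`--supports stmt-CriticalPhenomena-4575`, closed), prover `prim-cplus-coupling` (gen 31).  No definitions, no notations, no named facts,
no sorries; standard axioms.  Memo `prim-cplus-coupling/A5-COUPLING-gen31.md` §1, §2b.  The series theorem `coreClass_kernelMixFull_series` delivers
KB-MIX-FULL at ALL levels, so the leaf step `coreClass_kernelMixFull_leaf` applies on top of it exactly as on top of a domination map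
(`…CoreClassKernelMixFullMain`): middle graphs `a′a + (H₁ ·_c H₂) + bb′`.
* `Coefficientwise.coreClass_kernel_nonneg_leaf_series_leaf` — the kernel of `(a′a + (E₁ ∪ E₂) + bb′; a′, b′)` from proper maps of the blocks + OSR(E₁; c, a).
* `Coefficientwise.cwpa_coreClass_of_leaf_series_leaf` — CW-PA on the core class `N(x) = N(z) = {a′, b′}` over it, all monotone `f, g`.
[cite: KozmaNitzan2024, Questions 8–9 (§5.5 p. 36) (context: the Question-8 pocket covariance programme)]
-/

namespace Summit.CriticalPhenomena.PercolationContinuityZ3.Theorems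

open Finset Literature.Probability.Percolation

namespace Coefficientwise

variable {ι V : Type*}

open Classical in
/-- **Pendant edges at both ends of a series composition: the kernel.**  `E₁, E₂` in series at `c` (proper domination maps `ψ₁`, `ψ₂`, one-sided root
inequality for `(E₁; c, a)`), new pendant edges `e₁ = a′a`, `e₂ = b′b` (`a′, b′` fresh).  For every monotone `f` with `f ∅ = 0` and monotone `g`, the core-class
kernel of `(insert e₂ (insert e₁ (E₁ ∪ E₂)); a′, b′)` is `≥ 0`. [cite: KozmaNitzan2024, Questions 8–9 (§5.5 p. 36) (context)] -/
theorem coreClass_kernel_nonneg_leaf_series_leaf (ends : ι → Sym2 V) (E₁ E₂ : Finset ι) (c a b a' b' : V) (e₁ e₂ : ι) (hdisj : Disjoint E₁ E₂)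
    (hsep : ∀ i ∈ E₁, ∀ j ∈ E₂, ∀ u, u ∈ ends i → u ∈ ends j → u = c)
    (haE : ∀ j ∈ E₂, a ∉ ends j) (hbE : ∀ i ∈ E₁, b ∉ ends i) (hba : b ≠ a)
    (he₁ : e₁ ∉ E₁ ∪ E₂) (he₂ : e₂ ∉ insert e₁ (E₁ ∪ E₂)) (hends₁ : ends e₁ = s(a', a)) (hends₂ : ends e₂ = s(b', b))
    (ha'E : ∀ i ∈ E₁ ∪ E₂, a' ∉ ends i) (hb'E : ∀ i ∈ insert e₁ (E₁ ∪ E₂), b' ∉ ends i)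
    (ha'a : a' ≠ a) (ha'b : a' ≠ b) (hb'b : b' ≠ b) (hb'a' : b' ≠ a')
    (ψ₁ : Finset ι → Finset ι)
    (hψ₁E : ∀ ω, ω ⊆ E₁ → c ∉ openCluster (ends '' (↑ω : Set ι)) a → c ∉ openCluster (ends '' (↑(E₁ \ ω) : Set ι)) a → ψ₁ ω ⊆ E₁)
    (hψ₁cov : ∀ ω, ω ⊆ E₁ → c ∉ openCluster (ends '' (↑ω : Set ι)) a → c ∉ openCluster (ends '' (↑(E₁ \ ω) : Set ι)) a →
      openCluster (ends '' (↑ω : Set ι)) a ∪ openCluster (ends '' (↑(E₁ \ ω) : Set ι)) c ⊆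
        openCluster (ends '' (↑(ψ₁ ω) : Set ι)) a ∪ openCluster (ends '' (↑(ψ₁ ω) : Set ι)) c)
    (hψ₁inj : ∀ ω ω', ω ⊆ E₁ → c ∉ openCluster (ends '' (↑ω : Set ι)) a → c ∉ openCluster (ends '' (↑(E₁ \ ω) : Set ι)) a →
      ω' ⊆ E₁ → c ∉ openCluster (ends '' (↑ω' : Set ι)) a → c ∉ openCluster (ends '' (↑(E₁ \ ω') : Set ι)) a → ψ₁ ω = ψ₁ ω' → ω = ω')
    (hψ₁prop : ∀ ω, ω ⊆ E₁ → c ∉ openCluster (ends '' (↑ω : Set ι)) a → c ∉ openCluster (ends '' (↑(E₁ \ ω) : Set ι)) a →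
      c ∉ openCluster (ends '' (↑(ψ₁ ω) : Set ι)) a)
    (ψ₂ : Finset ι → Finset ι)
    (hψ₂E : ∀ ω, ω ⊆ E₂ → b ∉ openCluster (ends '' (↑ω : Set ι)) c → b ∉ openCluster (ends '' (↑(E₂ \ ω) : Set ι)) c → ψ₂ ω ⊆ E₂)
    (hψ₂cov : ∀ ω, ω ⊆ E₂ → b ∉ openCluster (ends '' (↑ω : Set ι)) c → b ∉ openCluster (ends '' (↑(E₂ \ ω) : Set ι)) c →
      openCluster (ends '' (↑ω : Set ι)) c ∪ openCluster (ends '' (↑(E₂ \ ω) : Set ι)) b ⊆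
        openCluster (ends '' (↑(ψ₂ ω) : Set ι)) c ∪ openCluster (ends '' (↑(ψ₂ ω) : Set ι)) b)
    (hψ₂inj : ∀ ω ω', ω ⊆ E₂ → b ∉ openCluster (ends '' (↑ω : Set ι)) c → b ∉ openCluster (ends '' (↑(E₂ \ ω) : Set ι)) c →
      ω' ⊆ E₂ → b ∉ openCluster (ends '' (↑ω' : Set ι)) c → b ∉ openCluster (ends '' (↑(E₂ \ ω') : Set ι)) c → ψ₂ ω = ψ₂ ω' → ω = ω')
    (hψ₂prop : ∀ ω, ω ⊆ E₂ → b ∉ openCluster (ends '' (↑ω : Set ι)) c → b ∉ openCluster (ends '' (↑(E₂ \ ω) : Set ι)) c →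
      b ∉ openCluster (ends '' (↑(ψ₂ ω) : Set ι)) c)
    (hOSR : ∀ H Hb K Kb : Set V → ℝ, Monotone H → Monotone Hb → Monotone K → Monotone Kb →
      (∀ X, 0 ≤ Hb X) → (∀ X, Hb X ≤ H X) → (∀ X, 0 ≤ Kb X) → (∀ X, Kb X ≤ K X) →
      0 ≤ ∑ ω₁ ∈ E₁.powerset, (if a ∈ openCluster (ends '' (↑ω₁ : Set ι)) c ∧ a ∉ openCluster (ends '' (↑(E₁ \ ω₁) : Set ι)) c then
        (H (openCluster (ends '' (↑ω₁ : Set ι)) c) - Hb (openCluster (ends '' (↑(E₁ \ ω₁) : Set ι)) c)) *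
          (K (openCluster (ends '' (↑ω₁ : Set ι)) c) - Kb (openCluster (ends '' (↑(E₁ \ ω₁) : Set ι)) c)) else 0))
    (f g : Set V → ℝ) (hf : Monotone f) (hf0 : f ∅ = 0) (hg : Monotone g) :
    0 ≤ (∑ ω ∈ (insert e₂ (insert e₁ (E₁ ∪ E₂))).powerset,
        f (openCluster (ends '' (↑ω : Set ι)) a' ∪ openCluster (ends '' (↑ω : Set ι)) b') *
          (g (openCluster (ends '' (↑ω : Set ι)) a' ∪ openCluster (ends '' (↑ω : Set ι)) b') - g ∅))
      + ∑ ω ∈ (insert e₂ (insert e₁ (E₁ ∪ E₂))).powerset.filter (fun ω : Finset ι => b' ∉ openCluster (ends '' (↑ω : Set ι)) a' ∧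
            b' ∉ openCluster (ends '' (↑((insert e₂ (insert e₁ (E₁ ∪ E₂))) \ ω) : Set ι)) a'),
        (f (openCluster (ends '' (↑ω : Set ι)) a') *
            (g (openCluster (ends '' (↑ω : Set ι)) a') - g (openCluster (ends '' (↑((insert e₂ (insert e₁ (E₁ ∪ E₂))) \ ω) : Set ι)) b'))
          + f (openCluster (ends '' (↑ω : Set ι)) b') *
            (g (openCluster (ends '' (↑ω : Set ι)) b') - g (openCluster (ends '' (↑((insert e₂ (insert e₁ (E₁ ∪ E₂))) \ ω) : Set ι)) a'))) := by
  set C : Finset ι → V → Set V := fun ω v => openCluster (ends '' (↑ω : Set ι)) v with hC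
  set F₁ : Finset ι := insert e₁ (E₁ ∪ E₂) with hF₁
  set F₂ : Finset ι := insert e₂ F₁ with hF₂
  -- stage 1: KB-MIX for (E₁; a', b) at all levels
  have s1 : ∀ h k ha hb ka kb : Set V → ℝ, Monotone h → Monotone k → Monotone ha → Monotone hb → Monotone ka → Monotone kb →
      (∀ X, 0 ≤ ha X) → (∀ X, ha X ≤ h X) → (∀ X, 0 ≤ hb X) → (∀ X, hb X ≤ h X) →
      (∀ X, 0 ≤ ka X) → (∀ X, ka X ≤ k X) → (∀ X, 0 ≤ kb X) → (∀ X, kb X ≤ k X) →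
      0 ≤ (∑ ω ∈ F₁.powerset, h (C ω a' ∪ C ω b) * k (C ω a' ∪ C ω b))
        + ∑ ω ∈ F₁.powerset.filter (fun ω : Finset ι => b ∉ C ω a' ∧ b ∉ C (F₁ \ ω) a'),
          (ha (C ω a') - hb (C (F₁ \ ω) b)) * (ka (C ω a') - kb (C (F₁ \ ω) b)) := by
    intro h k ha hb ka kb hh hk mha mhb mka mkb ha0 hah hb0 hbh ka0 kak kb0 kbk
    refine coreClass_kernelMixFull_leaf ends (E₁ ∪ E₂) e₁ a a' b he₁ hends₁ ha'E ha'a ha'b h k ha hb ka kb hh hk mha mhb mka mkb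
      ha0 hah hb0 hbh ka0 kak kb0 kbk ?_
    exact coreClass_kernelMixFull_series ends E₁ E₂ c a b hdisj hsep haE hbE hba (fun X => h (insert a' X)) (fun X => k (insert a' X))
      (fun X => ha (insert a' X)) hb (fun X => ka (insert a' X)) kb
      (fun X Y hXY => hh (Set.insert_subset_insert hXY)) (fun X Y hXY => hk (Set.insert_subset_insert hXY))
      (fun X Y hXY => mha (Set.insert_subset_insert hXY)) mhb (fun X Y hXY => mka (Set.insert_subset_insert hXY)) mkb
      (fun X => ha0 _) (fun X => hah _) (fun X => hb0 _) (fun X => le_trans (hbh X) (hh (Set.subset_insert _ _)))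
      (fun X => ka0 _) (fun X => kak _) (fun X => kb0 _) (fun X => le_trans (kbk X) (hk (Set.subset_insert _ _)))
      ψ₁ hψ₁E hψ₁cov hψ₁inj hψ₁prop ψ₂ hψ₂E hψ₂cov hψ₂inj hψ₂prop hOSR
  -- stage 2: KB-MIX for (E₁; b, a') at all levels (terminal symmetry)
  have s2 : ∀ h k ha hb ka kb : Set V → ℝ, Monotone h → Monotone k → Monotone ha → Monotone hb → Monotone ka → Monotone kb →
      (∀ X, 0 ≤ ha X) → (∀ X, ha X ≤ h X) → (∀ X, 0 ≤ hb X) → (∀ X, hb X ≤ h X) →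
      (∀ X, 0 ≤ ka X) → (∀ X, ka X ≤ k X) → (∀ X, 0 ≤ kb X) → (∀ X, kb X ≤ k X) →
      0 ≤ (∑ ω ∈ F₁.powerset, h (C ω b ∪ C ω a') * k (C ω b ∪ C ω a'))
        + ∑ ω ∈ F₁.powerset.filter (fun ω : Finset ι => a' ∉ C ω b ∧ a' ∉ C (F₁ \ ω) b),
          (ha (C ω b) - hb (C (F₁ \ ω) a')) * (ka (C ω b) - kb (C (F₁ \ ω) a')) := by
    intro h k ha hb ka kb hh hk mha mhb mka mkb ha0 hah hb0 hbh ka0 kak kb0 kbk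
    rw [coreClass_kernelMixFull_comm ends F₁ a' b h k hb ha kb ka]
    exact s1 h k hb ha kb ka hh hk mhb mha mkb mka hb0 hbh ha0 hah kb0 kbk ka0 kak
  -- stage 3: KB-MIX for (E₂; b', a') at all levels (leaf at b)
  have s3 : ∀ h k ha hb ka kb : Set V → ℝ, Monotone h → Monotone k → Monotone ha → Monotone hb → Monotone ka → Monotone kb →
      (∀ X, 0 ≤ ha X) → (∀ X, ha X ≤ h X) → (∀ X, 0 ≤ hb X) → (∀ X, hb X ≤ h X) →
      (∀ X, 0 ≤ ka X) → (∀ X, ka X ≤ k X) → (∀ X, 0 ≤ kb X) → (∀ X, kb X ≤ k X) →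
      0 ≤ (∑ ω ∈ F₂.powerset, h (C ω b' ∪ C ω a') * k (C ω b' ∪ C ω a'))
        + ∑ ω ∈ F₂.powerset.filter (fun ω : Finset ι => a' ∉ C ω b' ∧ a' ∉ C (F₂ \ ω) b'),
          (ha (C ω b') - hb (C (F₂ \ ω) a')) * (ka (C ω b') - kb (C (F₂ \ ω) a')) := by
    intro h k ha hb ka kb hh hk mha mhb mka mkb ha0 hah hb0 hbh ka0 kak kb0 kbk
    refine coreClass_kernelMixFull_leaf ends F₁ e₂ b b' a' he₂ hends₂ hb'E hb'b hb'a' h k ha hb ka kb hh hk mha mhb mka mkb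
      ha0 hah hb0 hbh ka0 kak kb0 kbk ?_
    exact s2 (fun X => h (insert b' X)) (fun X => k (insert b' X)) (fun X => ha (insert b' X)) hb (fun X => ka (insert b' X)) kb
      (fun X Y hXY => hh (Set.insert_subset_insert hXY)) (fun X Y hXY => hk (Set.insert_subset_insert hXY))
      (fun X Y hXY => mha (Set.insert_subset_insert hXY)) mhb (fun X Y hXY => mka (Set.insert_subset_insert hXY)) mkb
      (fun X => ha0 _) (fun X => hah _) (fun X => hb0 _) (fun X => le_trans (hbh X) (hh (Set.subset_insert _ _)))
      (fun X => ka0 _) (fun X => kak _) (fun X => kb0 _) (fun X => le_trans (kbk X) (hk (Set.subset_insert _ _)))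
  -- stage 4: back to (E₂; a', b') at equal levels, then the kernel
  have hf_nonneg : ∀ X : Set V, 0 ≤ f X := fun X => by rw [← hf0]; exact hf (Set.empty_subset X)
  have hg' : Monotone (fun X : Set V => g X - g ∅) := fun X Y hXY => sub_le_sub_right (hg hXY) _
  have hg0 : ∀ X : Set V, 0 ≤ g X - g ∅ := fun X => sub_nonneg.mpr (hg (Set.empty_subset X))
  have s4 : 0 ≤ (∑ ω ∈ F₂.powerset,
        f (C ω a' ∪ C ω b') * (g (C ω a' ∪ C ω b') - g ∅))
      + ∑ ω ∈ F₂.powerset.filter (fun ω : Finset ι => b' ∉ C ω a' ∧ b' ∉ C (F₂ \ ω) a'),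
        (f (C ω a') - f (C (F₂ \ ω) b')) * ((g (C ω a') - g ∅) - (g (C (F₂ \ ω) b') - g ∅)) := by
    rw [← coreClass_kernelMixFull_comm ends F₂ a' b' f (fun X : Set V => g X - g ∅) f f (fun X : Set V => g X - g ∅) (fun X : Set V => g X - g ∅)]
    exact s3 f (fun X : Set V => g X - g ∅) f f (fun X : Set V => g X - g ∅) (fun X : Set V => g X - g ∅) hf hg' hf hf hg' hg'
      hf_nonneg (fun X => le_refl _) hf_nonneg (fun X => le_refl _) hg0 (fun X => le_refl _) hg0 (fun X => le_refl _)
  exact coreClass_kernel_nonneg_of_kernelMixFull ends F₂ a' b' f g s4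


open Classical in
/-- **CW-PA on the core class over `a′a + (H₁ ·_c H₂) + bb′`.**  Core-class bookkeeping for the middle graph `E_H = insert e₂ (insert e₁ (E₁ ∪ E₂))` with terminals
`a′, b′`; hypotheses of `coreClass_kernel_nonneg_leaf_series_leaf`.  Then for all monotone `f, g`:
`0 ≤ Σ_{s ⊆ E₀ : z ∉ C_x(s), z ∉ C_x(E₀∖s)} f(C_x s)·(g(C_x s) − g(C_x(E₀∖s)))`. [cite: KozmaNitzan2024, Questions 8–9 (§5.5 p. 36) (context)] -/
theorem cwpa_coreClass_of_leaf_series_leaf (ends : ι → Sym2 V) (E₁ E₂ E₀ : Finset ι) (x z c a b a' b' : V) (e₁ e₂ ixa ixb iza izb : ι)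
    (hdisj : Disjoint E₁ E₂) (hsep : ∀ i ∈ E₁, ∀ j ∈ E₂, ∀ u, u ∈ ends i → u ∈ ends j → u = c)
    (haE : ∀ j ∈ E₂, a ∉ ends j) (hbE : ∀ i ∈ E₁, b ∉ ends i) (hba : b ≠ a)
    (he₁ : e₁ ∉ E₁ ∪ E₂) (he₂ : e₂ ∉ insert e₁ (E₁ ∪ E₂)) (hends₁ : ends e₁ = s(a', a)) (hends₂ : ends e₂ = s(b', b))
    (ha'E : ∀ i ∈ E₁ ∪ E₂, a' ∉ ends i) (hb'E : ∀ i ∈ insert e₁ (E₁ ∪ E₂), b' ∉ ends i)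
    (ha'a : a' ≠ a) (ha'b : a' ≠ b) (hb'b : b' ≠ b) (hb'a' : b' ≠ a')
    (hxa : ends ixa = s(x, a')) (hxb : ends ixb = s(x, b')) (hza : ends iza = s(z, a')) (hzb : ends izb = s(z, b'))
    (hH : ∀ i ∈ insert e₂ (insert e₁ (E₁ ∪ E₂)), x ∉ ends i ∧ z ∉ ends i)
    (hE₀ : ∀ i, i ∈ E₀ ↔ i ∈ insert e₂ (insert e₁ (E₁ ∪ E₂)) ∨ i = ixa ∨ i = ixb ∨ i = iza ∨ i = izb)
    (hnot : ixa ∉ insert e₂ (insert e₁ (E₁ ∪ E₂)) ∧ ixb ∉ insert e₂ (insert e₁ (E₁ ∪ E₂)) ∧ iza ∉ insert e₂ (insert e₁ (E₁ ∪ E₂)) ∧ izb ∉ insert e₂ (insert e₁ (E₁ ∪ E₂)))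
    (hd : ixa ≠ ixb ∧ ixa ≠ iza ∧ ixa ≠ izb ∧ ixb ≠ iza ∧ ixb ≠ izb ∧ iza ≠ izb)
    (hxz : x ≠ z) (hxa' : x ≠ a') (hxb' : x ≠ b') (hza' : z ≠ a') (hzb' : z ≠ b')
    (ψ₁ : Finset ι → Finset ι)
    (hψ₁E : ∀ ω, ω ⊆ E₁ → c ∉ openCluster (ends '' (↑ω : Set ι)) a → c ∉ openCluster (ends '' (↑(E₁ \ ω) : Set ι)) a → ψ₁ ω ⊆ E₁)
    (hψ₁cov : ∀ ω, ω ⊆ E₁ → c ∉ openCluster (ends '' (↑ω : Set ι)) a → c ∉ openCluster (ends '' (↑(E₁ \ ω) : Set ι)) a →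
      openCluster (ends '' (↑ω : Set ι)) a ∪ openCluster (ends '' (↑(E₁ \ ω) : Set ι)) c ⊆
        openCluster (ends '' (↑(ψ₁ ω) : Set ι)) a ∪ openCluster (ends '' (↑(ψ₁ ω) : Set ι)) c)
    (hψ₁inj : ∀ ω ω', ω ⊆ E₁ → c ∉ openCluster (ends '' (↑ω : Set ι)) a → c ∉ openCluster (ends '' (↑(E₁ \ ω) : Set ι)) a →
      ω' ⊆ E₁ → c ∉ openCluster (ends '' (↑ω' : Set ι)) a → c ∉ openCluster (ends '' (↑(E₁ \ ω') : Set ι)) a → ψ₁ ω = ψ₁ ω' → ω = ω')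
    (hψ₁prop : ∀ ω, ω ⊆ E₁ → c ∉ openCluster (ends '' (↑ω : Set ι)) a → c ∉ openCluster (ends '' (↑(E₁ \ ω) : Set ι)) a →
      c ∉ openCluster (ends '' (↑(ψ₁ ω) : Set ι)) a)
    (ψ₂ : Finset ι → Finset ι)
    (hψ₂E : ∀ ω, ω ⊆ E₂ → b ∉ openCluster (ends '' (↑ω : Set ι)) c → b ∉ openCluster (ends '' (↑(E₂ \ ω) : Set ι)) c → ψ₂ ω ⊆ E₂)
    (hψ₂cov : ∀ ω, ω ⊆ E₂ → b ∉ openCluster (ends '' (↑ω : Set ι)) c → b ∉ openCluster (ends '' (↑(E₂ \ ω) : Set ι)) c →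
      openCluster (ends '' (↑ω : Set ι)) c ∪ openCluster (ends '' (↑(E₂ \ ω) : Set ι)) b ⊆
        openCluster (ends '' (↑(ψ₂ ω) : Set ι)) c ∪ openCluster (ends '' (↑(ψ₂ ω) : Set ι)) b)
    (hψ₂inj : ∀ ω ω', ω ⊆ E₂ → b ∉ openCluster (ends '' (↑ω : Set ι)) c → b ∉ openCluster (ends '' (↑(E₂ \ ω) : Set ι)) c →
      ω' ⊆ E₂ → b ∉ openCluster (ends '' (↑ω' : Set ι)) c → b ∉ openCluster (ends '' (↑(E₂ \ ω') : Set ι)) c → ψ₂ ω = ψ₂ ω' → ω = ω')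
    (hψ₂prop : ∀ ω, ω ⊆ E₂ → b ∉ openCluster (ends '' (↑ω : Set ι)) c → b ∉ openCluster (ends '' (↑(E₂ \ ω) : Set ι)) c →
      b ∉ openCluster (ends '' (↑(ψ₂ ω) : Set ι)) c)
    (hOSR : ∀ H Hb K Kb : Set V → ℝ, Monotone H → Monotone Hb → Monotone K → Monotone Kb →
      (∀ X, 0 ≤ Hb X) → (∀ X, Hb X ≤ H X) → (∀ X, 0 ≤ Kb X) → (∀ X, Kb X ≤ K X) →
      0 ≤ ∑ ω₁ ∈ E₁.powerset, (if a ∈ openCluster (ends '' (↑ω₁ : Set ι)) c ∧ a ∉ openCluster (ends '' (↑(E₁ \ ω₁) : Set ι)) c then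
        (H (openCluster (ends '' (↑ω₁ : Set ι)) c) - Hb (openCluster (ends '' (↑(E₁ \ ω₁) : Set ι)) c)) *
          (K (openCluster (ends '' (↑ω₁ : Set ι)) c) - Kb (openCluster (ends '' (↑(E₁ \ ω₁) : Set ι)) c)) else 0))
    (f g : Set V → ℝ) (hf : Monotone f) (hg : Monotone g) :
    0 ≤ ∑ s ∈ E₀.powerset.filter (fun s : Finset ι => z ∉ openCluster (ends '' (↑s : Set ι)) x ∧ z ∉ openCluster (ends '' (↑(E₀ \ s) : Set ι)) x),
      f (openCluster (ends '' (↑s : Set ι)) x) * (g (openCluster (ends '' (↑s : Set ι)) x) - g (openCluster (ends '' (↑(E₀ \ s) : Set ι)) x)) :=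
  cwpa_coreClass_of_kernel ends (insert e₂ (insert e₁ (E₁ ∪ E₂))) E₀ x z a' b' ixa ixb iza izb hxa hxb hza hzb hH hE₀ hnot hd hxz hxa' hxb' hza' hzb'
    (fun f' g' hf' hf0' hg' => coreClass_kernel_nonneg_leaf_series_leaf ends E₁ E₂ c a b a' b' e₁ e₂ hdisj hsep haE hbE hba he₁ he₂ hends₁ hends₂ ha'E hb'E
      ha'a ha'b hb'b hb'a' ψ₁ hψ₁E hψ₁cov hψ₁inj hψ₁prop ψ₂ hψ₂E hψ₂cov hψ₂inj hψ₂prop hOSR f' g' hf' hf0' hg') f g hf hg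

end Coefficientwise

end Summit.CriticalPhenomena.PercolationContinuityZ3.Theorems
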